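import Mathlib.Data.List.PeriodicityLemma
import Mathlib.Data.List.Infix
import Mathlib.Data.List.Flatten
import Mathlib.Data.List.Range
import Mathlib.Data.Nat.GCD.Basic
import Mathlib.Data.Nat.Periodic
import Mathlib.Order.Lattice.Nat
import Mathlib.Tactic.Ring
import HarnessLib

/-!
# The theorem of Fine and Wilf: sequence form, overlap form, power form; commuting words

Mathlib (`Mathlib.Data.List.PeriodicityLemma`, Š. Holub 2025) has the notion of a period of a
word, `List.HasPeriod w p` (`w` is a prefix of `take p w ++ w`, equivalently `w[i]? = w[i+p]?`
for `i < |w| - p`), and the **Periodicity Lemma** `List.HasPeriod.gcd`: a word with periods `p`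
and `q` and length `≥ p + q - gcd p q` has period `gcd p q`.  This file adds, on top of that
lemma, the forms of the theorem that appear in the sources and are not in Mathlib:

* `periodic_eq_of_eq_init` — the original **Theorem 1 of Fine and Wilf (1965)**: two periodic
  sequences `f, g : ℕ → α` of periods `h, k > 0` which agree on the `h + k - gcd h k` consecutive
  integers `0, 1, …` agree everywhere [FineWilf1965, Thm 1]; with the optimality example of
  [FineWilf1965, Thm 1] / [Lothaire1997, Example 1.3.6] (`abaaba` has periods `3` and `5` but not
  `1 = gcd 3 5`; its `3`- and `5`-periodic continuations agree on `3 + 5 - 1 - 1 = 6` terms only).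
* `hasPeriod_overlap` — the overlap form [Lothaire1997, Thm 8.1.2]: if `w = w₁ u w₂`, `w₁ u` has
  period `p > 0`, `u w₂` has period `q > 0` and `|u| ≥ p + q - gcd p q`, then `w` has period
  `gcd p q` (Lothaire states it for the minimal periods `p = π(w₁u)`, `q = π(uw₂)`, concluding
  `p = q = π(w)`; `minPeriod_eq_of_overlap` is that formulation).
* `exists_eq_wordPow_of_prefix` — the power form [Lothaire1997, Prop 1.3.5]: if powers `x^k`
  and `y^l` have a common left factor of length `≥ |x| + |y| - gcd |x| |y|`, then `x` and `y` are
  powers of the same word.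
* `exists_eq_wordPow_of_wordPow_eq`, `existsUnique_isPrimitive_wordPow` — [Lothaire1997,
  Prop 1.3.1]: `x^n = y^m` (`n ≥ 1`) implies `x, y` are powers of a common word (here a corollary
  of Prop 1.3.5); every nonempty word is a power of a unique primitive word.
* `append_comm_iff_exists_wordPow` — [Lothaire1997, Prop 1.3.2, first assertion]
  (Lyndon–Schützenberger): `xy = yx` iff `x` and `y` are powers of the same word; and
  `hasPeriod_gcd_of_append_comm`: if `xy = yx` then `xy` has period `gcd |x| |y|`.

Supporting API (reversal invariance of `HasPeriod`, extension of a small period from a long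
prefix/suffix, gluing two overlapping periodic factors, periods of powers `wordPow x k = x^k`,
a word whose length is a multiple of a period `d` is a power of its prefix of length `d`) is
proved here because Mathlib does not have it; these are routine [folklore] facts and are kept
`private` where they are not part of the cited statements.

## Sources

* N. J. Fine, H. S. Wilf, *Uniqueness theorems for periodic functions*, Proc. Amer. Math. Soc.
  16 (1965) 109–114, Theorem 1 (discrete case) and its optimality clause. [FineWilf1965]
* M. Lothaire, *Combinatorics on Words*, Cambridge Math. Library, CUP 1997 (reprint of the 1983
  edition): §1.3 (primitive words; Prop. 1.3.1, Prop. 1.3.2, Prop. 1.3.5, Example 1.3.6) and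
  §8.1 (Prop. 8.1.1 (ii): `p` is a
  period of `w = a₁⋯aₙ` iff `aᵢ = aᵢ₊ₚ` identically; Thm. 8.1.2). [Lothaire1997]

## Mathlib

Used: `List.HasPeriod`, `List.hasPeriod_iff_getElem?`, `List.hasPeriod_iff_forall_getElem?_mod`,
`List.HasPeriod.getElem?_mod`, `List.HasPeriod.factor`, `List.HasPeriod.infix`,
`List.HasPeriod.drop_prefix`, `List.HasPeriod.gcd` (tag v4.32.0).  Not in Mathlib (searched
`PeriodicityLemma.lean`, `Fine`, `commute`/`append_comm` on lists, `FreeMonoid`): the two-sequence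
statement, the overlap statement, powers of a common word, primitive roots, commuting words
(Mathlib's `FreeMonoid` has no primitivity / Lyndon–Schützenberger lemma at this tag).
-/

namespace Literature.Combinatorics.Words

open List Nat

variable {α : Type*}

/-! ### Supporting facts about `List.HasPeriod` -/

/-- A period of a word is a period of its reversal. [folklore] -/
private theorem hasPeriod_reverse {w : List α} {p : ℕ} (hw : w.HasPeriod p) :
    w.reverse.HasPeriod p := by
  rw [List.hasPeriod_iff_getElem?] at hw ⊢
  intro i hi
  rw [List.length_reverse] at hi
  rw [List.getElem?_reverse (by omega), List.getElem?_reverse (by omega)]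
  have h := hw (w.length - 1 - (i + p)) (by omega)
  rw [show w.length - 1 - (i + p) + p = w.length - 1 - i by omega] at h
  exact h.symm

/-- Reversal does not change the periods of a word. [folklore] -/
private theorem hasPeriod_reverse_iff {w : List α} {p : ℕ} :
    w.reverse.HasPeriod p ↔ w.HasPeriod p :=
  ⟨fun h => by simpa using hasPeriod_reverse h, hasPeriod_reverse⟩

/-- Extension of a small period from a long prefix: if `u ++ v` has period `p > 0`, its prefix
`u` of length `≥ p` has period `d` and `d ∣ p`, then `u ++ v` has period `d`. [folklore] -/
private theorem hasPeriod_append_of_prefix {u v : List α} {p d : ℕ} (hw : (u ++ v).HasPeriod p)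
    (hu : u.HasPeriod d) (hdp : d ∣ p) (hp : 0 < p) (hlen : p ≤ u.length) :
    (u ++ v).HasPeriod d := by
  rcases Nat.eq_zero_or_pos d with rfl | hd
  · exact absurd (zero_dvd_iff.mp hdp) hp.ne'
  rw [List.hasPeriod_iff_forall_getElem?_mod] at hu ⊢
  intro i hi
  have h1 : (u ++ v)[i]? = (u ++ v)[i % p]? := (hw.getElem?_mod p i _ hi).symm
  have hip : i % p < u.length := (Nat.mod_lt i hp).trans_le hlen
  have hid : i % d < u.length := (Nat.mod_lt i hd).trans_le ((Nat.le_of_dvd hp hdp).trans hlen)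
  rw [h1, List.getElem?_append_left hip, List.getElem?_append_left hid, hu (i % p) hip,
    Nat.mod_mod_of_dvd i hdp]

/-- The mirror image: if `v ++ u` has period `p > 0`, its suffix `u` of length `≥ p` has period
`d` and `d ∣ p`, then `v ++ u` has period `d`. [folklore] -/
private theorem hasPeriod_append_of_suffix {v u : List α} {p d : ℕ} (hw : (v ++ u).HasPeriod p)
    (hu : u.HasPeriod d) (hdp : d ∣ p) (hp : 0 < p) (hlen : p ≤ u.length) :
    (v ++ u).HasPeriod d := by
  rw [← hasPeriod_reverse_iff, List.reverse_append] at hw ⊢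
  exact hasPeriod_append_of_prefix hw (hasPeriod_reverse hu) hdp hp (by simpa using hlen)

/-- Gluing: if `w₁ ++ u` and `u ++ w₂` both have period `d` and the overlap `u` has length `≥ d`,
then `w₁ ++ u ++ w₂` has period `d`. [folklore] -/
private theorem hasPeriod_glue {w₁ u w₂ : List α} {d : ℕ} (h₁ : (w₁ ++ u).HasPeriod d)
    (h₂ : (u ++ w₂).HasPeriod d) (hlen : d ≤ u.length) : (w₁ ++ u ++ w₂).HasPeriod d := by
  rw [List.hasPeriod_iff_getElem?] at h₁ h₂ ⊢
  intro i hi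
  simp only [List.length_append] at hi h₁ h₂
  by_cases hlt : i + d < w₁.length + u.length
  · -- both positions inside `w₁ ++ u`
    have e1 : (w₁ ++ u ++ w₂)[i]? = (w₁ ++ u)[i]? :=
      List.getElem?_append_left (by rw [List.length_append]; omega)
    have e2 : (w₁ ++ u ++ w₂)[i + d]? = (w₁ ++ u)[i + d]? :=
      List.getElem?_append_left (by rw [List.length_append]; omega)
    rw [e1, e2]
    exact h₁ i (by omega)
  · -- both positions inside `u ++ w₂` (as `i ≥ |w₁|` because `|u| ≥ d`)
    have hi₁ : w₁.length ≤ i := by omega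
    have e1 : (w₁ ++ u ++ w₂)[i]? = (u ++ w₂)[i - w₁.length]? := by
      rw [List.append_assoc, List.getElem?_append_right hi₁]
    have e2 : (w₁ ++ u ++ w₂)[i + d]? = (u ++ w₂)[i - w₁.length + d]? := by
      rw [List.append_assoc, List.getElem?_append_right (show w₁.length ≤ i + d by omega),
        show i + d - w₁.length = i - w₁.length + d by omega]
    rw [e1, e2]
    exact h₂ (i - w₁.length) (by omega)

/-! ### Fine and Wilf 1965, Theorem 1: two periodic sequences -/

/-- **Fine–Wilf, Theorem 1 (discrete case).** Let `f` and `g` be periodic sequences of periods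
`h > 0` and `k > 0`.  If `f n = g n` for the `h + k - gcd h k` consecutive integers
`n = 0, 1, …, h + k - gcd h k - 1`, then `f n = g n` for all `n`. (Agreement on any other block of
`h + k - gcd h k` consecutive integers reduces to this by a shift.) [cite: FineWilf1965, Thm 1] -/
theorem periodic_eq_of_eq_init {f g : ℕ → α} {h k : ℕ} (hh : 0 < h) (hk : 0 < k)
    (hf : Function.Periodic f h) (hg : Function.Periodic g k)
    (hfg : ∀ n < h + k - Nat.gcd h k, f n = g n) : f = g := by
  set d := Nat.gcd h k with hd
  set N := h + k - d with hN
  have hdk : d ≤ k := Nat.le_of_dvd hk (Nat.gcd_dvd_right h k)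
  have hdh : d ≤ h := Nat.le_of_dvd hh (Nat.gcd_dvd_left h k)
  -- the window `f 0, …, f (N-1)` as a word
  set w : List α := (List.range N).map f with hw
  have hwlen : w.length = N := by simp [hw]
  have hwget : ∀ i, i < N → w[i]? = some (f i) := by
    intro i hi
    simp [hw, List.getElem?_map, List.getElem?_range hi]
  have per_h : w.HasPeriod h := by
    rw [List.hasPeriod_iff_getElem?]
    intro i hi
    rw [hwlen] at hi
    rw [hwget i (by omega), hwget (i + h) (by omega), hf i]
  have per_k : w.HasPeriod k := by
    rw [List.hasPeriod_iff_getElem?]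
    intro i hi
    rw [hwlen] at hi
    rw [hwget i (by omega), hwget (i + k) (by omega), hfg i (by omega), hfg (i + k) (by omega),
      hg i]
  have per_d : w.HasPeriod d := per_h.gcd per_k (by rw [hwlen])
  funext n
  have hnh : n % h < N := by have := Nat.mod_lt n hh; omega
  have hnk : n % k < N := by have := Nat.mod_lt n hk; omega
  have e1 : w[n % h]? = w[n % d]? := by
    rw [← per_d.getElem?_mod d (n % h) w (by rw [hwlen]; exact hnh),
      Nat.mod_mod_of_dvd n (Nat.gcd_dvd_left h k)]
  have e2 : w[n % k]? = w[n % d]? := by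
    rw [← per_d.getElem?_mod d (n % k) w (by rw [hwlen]; exact hnk),
      Nat.mod_mod_of_dvd n (Nat.gcd_dvd_right h k)]
  have e3 : f (n % h) = f (n % k) :=
    Option.some.inj (by rw [← hwget _ hnh, ← hwget _ hnk, e1, e2])
  rw [← hf.map_mod_nat n, ← hg.map_mod_nat n, e3, hfg (n % k) (by have := Nat.mod_lt n hk; omega)]

/-- Optimality of the bound `h + k - gcd h k` [cite: FineWilf1965, Thm 1] ("the result would be
false if `h + k - (h, k)` were replaced by anything smaller"), in the instance `h = 3`, `k = 5`
of [cite: Lothaire1997, Example 1.3.6]: the `3`-periodic and the `5`-periodic continuations of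
`abaaba` agree on the `3 + 5 - 1 - 1 = 6` integers `0, …, 5` and differ at `6`. -/
example :
    let u : List Bool := [false, true, false, false, true, false]
    let f : ℕ → Bool := fun n => u[n % 3]!
    let g : ℕ → Bool := fun n => u[n % 5]!
    Function.Periodic f 3 ∧ Function.Periodic g 5 ∧ (∀ n < 3 + 5 - Nat.gcd 3 5 - 1, f n = g n) ∧
      f 6 ≠ g 6 := by
  refine ⟨fun n => by simp, fun n => by simp, by decide, by decide⟩

/-- The same witness in the language of words [cite: Lothaire1997, Example 1.3.6]: `abaaba`
(the common left factor of `f₅² = (abaab)²` and `f₄³ = (aba)³` of length `λ₅ + λ₄ - 2 = 6`) has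
periods `5` and `3` but not period `gcd 5 3 = 1`, so the length bound `p + q - gcd p q = 7` in the
Periodicity Lemma `List.HasPeriod.gcd` cannot be lowered to `6`. -/
example :
    let u : List Bool := [false, true, false, false, true, false]
    u.HasPeriod 5 ∧ u.HasPeriod 3 ∧ ¬ u.HasPeriod (Nat.gcd 5 3) ∧ u.length = 5 + 3 - Nat.gcd 5 3 - 1 := by
  simp only [List.HasPeriod]
  decide

/-! ### The overlap form (Lothaire, Theorem 8.1.2) -/

/-- **Fine–Wilf, overlap form.** If `w₁ ++ u` has period `p > 0`, `u ++ w₂` has period `q > 0`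
and the common factor `u` has length `≥ p + q - gcd p q`, then `w₁ ++ u ++ w₂` has period
`gcd p q` (hence `w₁ ++ u` and `u ++ w₂` have it too).  This is Theorem 8.1.2 of Lothaire for
arbitrary (not necessarily minimal) periods; see `minPeriod_eq_of_overlap` for the statement with
minimal periods. [cite: Lothaire1997, Thm 8.1.2] -/
theorem hasPeriod_overlap {w₁ u w₂ : List α} {p q : ℕ} (hp : 0 < p) (hq : 0 < q)
    (h₁ : (w₁ ++ u).HasPeriod p) (h₂ : (u ++ w₂).HasPeriod q)
    (hlen : p + q - Nat.gcd p q ≤ u.length) : (w₁ ++ u ++ w₂).HasPeriod (Nat.gcd p q) := by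
  have hdp : Nat.gcd p q ≤ p := Nat.le_of_dvd hp (Nat.gcd_dvd_left p q)
  have hdq : Nat.gcd p q ≤ q := Nat.le_of_dvd hq (Nat.gcd_dvd_right p q)
  have hu_p : u.HasPeriod p := (show (w₁ ++ u ++ []).HasPeriod p by simpa using h₁).factor
  have hu_q : u.HasPeriod q := (show ([] ++ u ++ w₂).HasPeriod q by simpa using h₂).factor
  have hu : u.HasPeriod (Nat.gcd p q) := hu_p.gcd hu_q hlen
  have e₁ : (w₁ ++ u).HasPeriod (Nat.gcd p q) :=
    hasPeriod_append_of_suffix h₁ hu (Nat.gcd_dvd_left p q) hp (by omega)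
  have e₂ : (u ++ w₂).HasPeriod (Nat.gcd p q) :=
    hasPeriod_append_of_prefix h₂ hu (Nat.gcd_dvd_right p q) hq (by omega)
  exact hasPeriod_glue e₁ e₂ (by omega)

/-- The **minimal period** `π(w)` of a word `w` (Lothaire, §8.1: the least positive `p` with
`aᵢ = aᵢ₊ₚ` identically, Prop. 8.1.1 (ii); it is at most `|w|` for a nonempty word).  Defined as
the infimum of the positive periods of `w`; for the empty word (every `p` is a period) this gives
`π(ε) = 1`. [cite: Lothaire1997, §8.1, Prop 8.1.1] -/
noncomputable def minPeriod (w : List α) : ℕ := sInf {p : ℕ | 0 < p ∧ w.HasPeriod p}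

/-- The set of positive periods of a word is nonempty (`max 1 |w|` is one). [folklore] -/
private theorem minPeriod_set_nonempty (w : List α) : {p : ℕ | 0 < p ∧ w.HasPeriod p}.Nonempty :=
  ⟨max 1 w.length, lt_max_of_lt_left Nat.one_pos,
    List.hasPeriod_of_length_le w _ (le_max_right _ _)⟩

/-- `π(w)` is a positive period of `w`, and the least such. [cite: Lothaire1997, Prop 8.1.1] -/
theorem minPeriod_spec (w : List α) :
    0 < minPeriod w ∧ w.HasPeriod (minPeriod w) ∧
      ∀ p, 0 < p → w.HasPeriod p → minPeriod w ≤ p := by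
  have hmem := Nat.sInf_mem (minPeriod_set_nonempty w)
  exact ⟨hmem.1, hmem.2, fun p hp hper => Nat.sInf_le ⟨hp, hper⟩⟩

/-- `π(w) ≤ |w|` for a nonempty word. [cite: Lothaire1997, §8.1] -/
theorem minPeriod_le_length {w : List α} (hw : w ≠ []) : minPeriod w ≤ w.length :=
  (minPeriod_spec w).2.2 _ (List.length_pos_of_ne_nil hw) (List.hasPeriod_of_length_le w _ le_rfl)

/-- **Lothaire, Theorem 8.1.2** (Fine–Wilf in the notation of minimal periods). Let
`w = w₁ u w₂`, `p' = π(w₁u)`, `p'' = π(uw₂)` and `d = gcd(p', p'')`.  If `|u| ≥ p' + p'' - d`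
then `p' = p'' = π(w)`. [cite: Lothaire1997, Thm 8.1.2] -/
theorem minPeriod_eq_of_overlap {w₁ u w₂ : List α}
    (hlen : minPeriod (w₁ ++ u) + minPeriod (u ++ w₂)
      - Nat.gcd (minPeriod (w₁ ++ u)) (minPeriod (u ++ w₂)) ≤ u.length) :
    minPeriod (w₁ ++ u) = minPeriod (w₁ ++ u ++ w₂) ∧
      minPeriod (u ++ w₂) = minPeriod (w₁ ++ u ++ w₂) := by
  obtain ⟨hp, hper₁, hmin₁⟩ := minPeriod_spec (w₁ ++ u)
  obtain ⟨hq, hper₂, hmin₂⟩ := minPeriod_spec (u ++ w₂)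
  obtain ⟨hr, hper, hmin⟩ := minPeriod_spec (w₁ ++ u ++ w₂)
  set p := minPeriod (w₁ ++ u)
  set q := minPeriod (u ++ w₂)
  set r := minPeriod (w₁ ++ u ++ w₂)
  have hd : 0 < Nat.gcd p q := Nat.gcd_pos_of_pos_left q hp
  -- `w` has period `gcd p q`, so `r ≤ gcd p q ≤ p, q`
  have hwd : (w₁ ++ u ++ w₂).HasPeriod (Nat.gcd p q) := hasPeriod_overlap hp hq hper₁ hper₂ hlen
  have hrd : r ≤ Nat.gcd p q := hmin _ hd hwd
  have hdp : Nat.gcd p q ≤ p := Nat.le_of_dvd hp (Nat.gcd_dvd_left p q)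
  have hdq : Nat.gcd p q ≤ q := Nat.le_of_dvd hq (Nat.gcd_dvd_right p q)
  -- a period of `w` is a period of its factors `w₁u` and `uw₂`, so `p, q ≤ r`
  have hpr : p ≤ r := hmin₁ r hr
    (show ([] ++ (w₁ ++ u) ++ w₂).HasPeriod r by simpa using hper).factor
  have hqr : q ≤ r := hmin₂ r hr
    (show (w₁ ++ (u ++ w₂) ++ []).HasPeriod r by simpa [List.append_assoc] using hper).factor
  constructor <;> omega

/-! ### Powers of a word and the power form (Lothaire, Proposition 1.3.5) -/

/-- The `k`-th power `x^k = x x ⋯ x` (`k` factors) of a word `x` in the free monoid `A*`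
(Lothaire §1.1; `x ∈ z*` iff `x` is a power of `z`, §1.3). [cite: Lothaire1997, §1.3] -/
def wordPow (x : List α) (k : ℕ) : List α := (List.replicate k x).flatten

/-- `x^0 = ε`. [cite: Lothaire1997, §1.3] -/
@[simp] theorem wordPow_zero (x : List α) : wordPow x 0 = [] := rfl

/-- `x^(k+1) = x x^k`. [cite: Lothaire1997, §1.3] -/
theorem wordPow_succ (x : List α) (k : ℕ) : wordPow x (k + 1) = x ++ wordPow x k := by
  simp [wordPow, List.replicate_succ]

/-- `x^(m+n) = x^m x^n`. [cite: Lothaire1997, §1.3] -/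
theorem wordPow_add (x : List α) (m n : ℕ) : wordPow x (m + n) = wordPow x m ++ wordPow x n := by
  induction m with
  | zero => simp
  | succ m ih => rw [Nat.add_right_comm, wordPow_succ, wordPow_succ, ih, List.append_assoc]

/-- `|x^k| = k |x|` (length is a morphism onto `(ℕ, +)`, Lothaire §1.1).
[cite: Lothaire1997, §1.1] -/
@[simp] theorem length_wordPow (x : List α) (k : ℕ) : (wordPow x k).length = k * x.length := by
  induction k with
  | zero => simp
  | succ k ih => rw [wordPow_succ, List.length_append, ih]; ring

/-- `ε^k = ε`. [cite: Lothaire1997, §1.3] -/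
@[simp] theorem wordPow_nil (k : ℕ) : wordPow ([] : List α) k = [] := by
  induction k with
  | zero => rfl
  | succ k ih => rw [wordPow_succ, ih]; rfl

/-- `x^1 = x`. [cite: Lothaire1997, §1.3] -/
theorem wordPow_one (x : List α) : wordPow x 1 = x := by
  rw [wordPow_succ, wordPow_zero, List.append_nil]

/-- `x^(k+1) = x^k x`. [cite: Lothaire1997, §1.3] -/
theorem wordPow_succ' (x : List α) (k : ℕ) : wordPow x (k + 1) = wordPow x k ++ x := by
  rw [wordPow_add, wordPow_one]

/-- `x^(m n) = (x^m)^n`. [cite: Lothaire1997, §1.3] -/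
theorem wordPow_mul (x : List α) (m n : ℕ) : wordPow x (m * n) = wordPow (wordPow x m) n := by
  induction n with
  | zero => simp
  | succ n ih => rw [Nat.mul_succ, wordPow_add, ih, wordPow_succ']

/-- Letters of a power: `(x^k)ᵢ = x_{i mod |x|}` (a power of `x` is covered by consecutive copies
of `x`, Lothaire §8.1). [cite: Lothaire1997, §8.1] -/
theorem getElem?_wordPow (x : List α) (k : ℕ) {i : ℕ} (hi : i < k * x.length) :
    (wordPow x k)[i]? = x[i % x.length]? := by
  induction k generalizing i with
  | zero => simp at hi
  | succ k ih =>
    rw [wordPow_succ]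
    by_cases hlt : i < x.length
    · rw [List.getElem?_append_left hlt, Nat.mod_eq_of_lt hlt]
    · have hi' : i - x.length < k * x.length := by rw [Nat.succ_mul] at hi; omega
      rw [List.getElem?_append_right (by omega), ih hi']
      conv_rhs => rw [show i = i - x.length + x.length by omega, Nat.add_mod_right]

/-- A power `x^k` has period `|x|` (Lothaire §8.1: the words of length `p` admitting `w` as a
factor of one of their powers are exactly the cyclic roots when `p = π(w)`). [cite: Lothaire1997, §8.1] -/
theorem hasPeriod_wordPow (x : List α) (k : ℕ) : (wordPow x k).HasPeriod x.length := by
  rw [List.hasPeriod_iff_getElem?]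
  intro i hi
  rw [length_wordPow] at hi
  rw [getElem?_wordPow x k (by omega), getElem?_wordPow x k (by omega), Nat.add_mod_right]

/-- A left factor of a power `x^k` has period `|x|`. [cite: Lothaire1997, §8.1] -/
theorem hasPeriod_of_prefix_wordPow {u x : List α} {k : ℕ} (h : u <+: wordPow x k) :
    u.HasPeriod x.length :=
  (hasPeriod_wordPow x k).infix h.isInfix

/-- A word with a period `d` dividing its length is the `(|w|/d)`-th power of its left factor of
length `d` (Lothaire §8.1, "periodic" words and cyclic roots). [cite: Lothaire1997, §8.1] -/
theorem eq_wordPow_of_hasPeriod {w : List α} {d : ℕ} (hw : w.HasPeriod d) (hdw : d ∣ w.length) :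
    w = wordPow (w.take d) (w.length / d) := by
  rcases Nat.eq_zero_or_pos d with rfl | hd
  · simp only [zero_dvd_iff, List.length_eq_zero_iff] at hdw
    subst hdw; simp
  obtain ⟨c, hc⟩ := hdw
  rw [hc, Nat.mul_div_cancel_left c hd]
  induction c generalizing w with
  | zero =>
    simp only [Nat.mul_zero, List.length_eq_zero_iff] at hc
    subst hc; simp
  | succ c ih =>
    have hdrop : (w.drop d).HasPeriod d :=
      (show (w.take d ++ w.drop d ++ []).HasPeriod d by simpa using hw).factor
    have hc' : (w.drop d).length = d * c := by rw [List.length_drop, hc, Nat.mul_succ]; omega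
    have key : wordPow ((w.drop d).take d) c = wordPow (w.take d) c := by
      rcases Nat.eq_zero_or_pos c with rfl | hcpos
      · simp
      · obtain ⟨z, hz⟩ := List.HasPeriod.drop_prefix d hw
        have hge : d ≤ (w.drop d).length := by rw [hc']; exact Nat.le_mul_of_pos_right d hcpos
        rw [← List.take_append_of_le_length (l₂ := z) hge, hz]
    conv_lhs => rw [← List.take_append_drop d w]
    rw [wordPow_succ, ← key, ← ih hdrop hc']

/-- **Lothaire, Proposition 1.3.5** (Fine–Wilf, power form). Let `x, y` be words,
`n = |x|`, `m = |y|`, `d = gcd(n, m)`.  If two powers `x^k` and `y^l` have a common left factor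
`u` of length at least `n + m - d`, then `x` and `y` are powers of the same word (namely of the
left factor of `u` of length `d`). [cite: Lothaire1997, Prop 1.3.5] -/
theorem exists_eq_wordPow_of_prefix {x y u : List α} {k l : ℕ} (hx : u <+: wordPow x k)
    (hy : u <+: wordPow y l)
    (hlen : x.length + y.length - Nat.gcd x.length y.length ≤ u.length) :
    ∃ z : List α, ∃ m n : ℕ, x = wordPow z m ∧ y = wordPow z n := by
  by_cases hx0 : x = []
  · exact ⟨y, 0, 1, by simp [hx0], (wordPow_one y).symm⟩
  by_cases hy0 : y = []
  · exact ⟨x, 1, 0, (wordPow_one x).symm, by simp [hy0]⟩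
  have hn0 : 0 < x.length := List.length_pos_of_ne_nil hx0
  have hm0 : 0 < y.length := List.length_pos_of_ne_nil hy0
  have hdn : Nat.gcd x.length y.length ≤ x.length := Nat.le_of_dvd hn0 (Nat.gcd_dvd_left _ _)
  have hdm : Nat.gcd x.length y.length ≤ y.length := Nat.le_of_dvd hm0 (Nat.gcd_dvd_right _ _)
  have hu : u.HasPeriod (Nat.gcd x.length y.length) :=
    (hasPeriod_of_prefix_wordPow hx).gcd (hasPeriod_of_prefix_wordPow hy) hlen
  -- extraction of a base word `v` from its power having `u` as a long left factor
  have key : ∀ {v : List α} {j : ℕ}, v ≠ [] → u <+: wordPow v j → v.length ≤ u.length →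
      Nat.gcd x.length y.length ∣ v.length →
      v = wordPow (u.take (Nat.gcd x.length y.length)) (v.length / Nat.gcd x.length y.length) := by
    intro v j hv hpre hle hdv
    obtain ⟨j', rfl⟩ : ∃ j', j = j' + 1 := by
      rcases j with _ | j'
      · exfalso
        rw [wordPow_zero, List.prefix_nil] at hpre
        subst hpre
        simp only [List.length_nil, Nat.le_zero, List.length_eq_zero_iff] at hle
        exact hv hle
      · exact ⟨j', rfl⟩
    have hv_eq : u.take v.length = v := by
      have hpre' := List.prefix_iff_eq_take.mp hpre
      rw [hpre', List.take_take, Nat.min_eq_left hle, wordPow_succ,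
        List.take_append_of_le_length le_rfl, List.take_length]
    have hper : (u.take v.length).HasPeriod (Nat.gcd x.length y.length) :=
      hu.infix (List.take_prefix _ u).isInfix
    have h1 : v = wordPow (v.take (Nat.gcd x.length y.length))
        (v.length / Nat.gcd x.length y.length) := by
      have := eq_wordPow_of_hasPeriod hper (by rw [hv_eq]; exact hdv)
      rwa [hv_eq] at this
    have h2 : v.take (Nat.gcd x.length y.length) = u.take (Nat.gcd x.length y.length) := by
      rw [← hv_eq, List.take_take,
        Nat.min_eq_left (Nat.le_of_dvd (List.length_pos_of_ne_nil hv) hdv)]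
    rw [h2] at h1
    exact h1
  exact ⟨u.take (Nat.gcd x.length y.length), x.length / Nat.gcd x.length y.length,
    y.length / Nat.gcd x.length y.length, key hx0 hx (by omega) (Nat.gcd_dvd_left _ _),
    key hy0 hy (by omega) (Nat.gcd_dvd_right _ _)⟩

/-! ### Equal powers and primitive roots (Lothaire, Proposition 1.3.1) -/

/-- **Lothaire, Proposition 1.3.1** (first assertion). If `x^n = y^m` with `n ≥ 1` (the source
also assumes `m ≥ 1`, which is not needed: for `m = 0` the hypothesis forces `x = ε`), then `x`
and `y` are powers of the same word.  (Derived here from Proposition 1.3.5 applied to the common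
left factor `x^(nj) = y^(mj)`, `j = |x| + |y|`; Lothaire derives it from the defect theorem.)
[cite: Lothaire1997, Prop 1.3.1] -/
theorem exists_eq_wordPow_of_wordPow_eq {x y : List α} {n m : ℕ} (hn : 0 < n)
    (h : wordPow x n = wordPow y m) :
    ∃ z : List α, ∃ k l : ℕ, x = wordPow z k ∧ y = wordPow z l := by
  by_cases hx0 : x = []
  · exact ⟨y, 0, 1, by simp [hx0], (wordPow_one y).symm⟩
  by_cases hy0 : y = []
  · exact ⟨x, 1, 0, (wordPow_one x).symm, by simp [hy0]⟩
  set j := x.length + y.length with hj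
  have hu : wordPow x (n * j) = wordPow y (m * j) := by rw [wordPow_mul, wordPow_mul, h]
  refine exists_eq_wordPow_of_prefix (List.prefix_rfl (l := wordPow x (n * j)))
    (by rw [hu]) ?_
  rw [length_wordPow]
  have hx1 : 1 ≤ n * x.length := Nat.one_le_iff_ne_zero.mpr
    (Nat.mul_ne_zero hn.ne' (List.length_pos_of_ne_nil hx0).ne')
  calc x.length + y.length - Nat.gcd x.length y.length ≤ j := Nat.sub_le _ _
    _ = 1 * j := (Nat.one_mul j).symm
    _ ≤ n * x.length * j := Nat.mul_le_mul_right j hx1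
    _ = n * j * x.length := by ring

/-- A word is **primitive** if it is nonempty and is not a power of another word: `x ≠ ε` and
`x ∈ z*` implies `z = x` (Lothaire §1.3). [cite: Lothaire1997, §1.3] -/
def IsPrimitive (x : List α) : Prop := x ≠ [] ∧ ∀ (z : List α) (k : ℕ), x = wordPow z k → z = x

/-- **Lothaire, Proposition 1.3.1** (second assertion): every nonempty word is a power of a unique
primitive word (its primitive root). [cite: Lothaire1997, Prop 1.3.1] -/
theorem existsUnique_isPrimitive_wordPow {w : List α} (hw : w ≠ []) :
    ∃! x : List α, IsPrimitive x ∧ ∃ n, w = wordPow x n := by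
  classical
  -- existence: a root of minimal length is primitive
  let P : ℕ → Prop := fun ℓ => ∃ x : List α, x.length = ℓ ∧ ∃ n, w = wordPow x n
  have hP : ∃ ℓ, P ℓ := ⟨w.length, w, rfl, 1, (wordPow_one w).symm⟩
  obtain ⟨x₀, hx₀, n₀, hwn⟩ := Nat.find_spec hP
  have hx₀ne : x₀ ≠ [] := by rintro rfl; exact hw (by simpa using hwn)
  have hprim : IsPrimitive x₀ := by
    refine ⟨hx₀ne, fun z k hzk => ?_⟩
    rcases k with _ | k
    · exact absurd (by simpa using hzk) hx₀ne
    rcases k with _ | k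
    · rw [hzk, wordPow_one]
    · -- `x₀ = z^(k+2)` with `|z| < |x₀|` would contradict minimality
      exfalso
      have hz : z ≠ [] := by rintro rfl; exact hx₀ne (by simpa using hzk)
      have hlt : z.length < x₀.length := by
        rw [hzk, length_wordPow]
        have := List.length_pos_of_ne_nil hz
        have e : (k + 1 + 1) * z.length = k * z.length + z.length + z.length := by ring
        omega
      have hPz : P z.length := ⟨z, rfl, (k + 2) * n₀, by rw [hwn, hzk, ← wordPow_mul]⟩
      exact Nat.find_min hP (hx₀ ▸ hlt) hPz
  refine ⟨x₀, ⟨hprim, n₀, hwn⟩, ?_⟩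
  -- uniqueness: two primitive roots are powers of a common word, hence equal
  rintro x ⟨⟨hxne, hxprim⟩, n, hwx⟩
  have hn : 0 < n := by
    rcases Nat.eq_zero_or_pos n with rfl | h
    · exact absurd (by simpa using hwx) hw
    · exact h
  obtain ⟨s, k, l, hxs, hx₀s⟩ := exists_eq_wordPow_of_wordPow_eq hn (hwx.symm.trans hwn)
  rw [← hxprim s k hxs, ← hprim.2 s l hx₀s]

/-! ### Commuting words (Lothaire, Proposition 1.3.2) -/

/-- `xy = yx` implies `x, y` are powers of a common word, by induction on `|x| + |y|`.
[folklore] -/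
private theorem exists_wordPow_of_append_comm : ∀ (s : ℕ) {x y : List α},
    x.length + y.length = s → x ++ y = y ++ x →
    ∃ z : List α, ∃ m n : ℕ, x = wordPow z m ∧ y = wordPow z n := by
  intro s
  induction s using Nat.strong_induction_on with
  | _ s ih =>
  intro x y hs h
  by_cases hx : x = []
  · exact ⟨y, 0, 1, by simp [hx], (wordPow_one y).symm⟩
  by_cases hy : y = []
  · exact ⟨x, 1, 0, (wordPow_one x).symm, by simp [hy]⟩
  have hx' : 0 < x.length := List.length_pos_of_ne_nil hx
  have hy' : 0 < y.length := List.length_pos_of_ne_nil hy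
  rcases List.append_eq_append_iff.mp h with ⟨a, hya, hyb⟩ | ⟨c, hxc, hxd⟩
  · -- `y = x a = a x`: recurse on the shorter pair `(x, a)`
    have hax : x ++ a = a ++ x := by rw [← hya, ← hyb]
    have hlen : y.length = x.length + a.length := by rw [hya, List.length_append]
    obtain ⟨z, m, n, rfl, rfl⟩ := ih (x.length + a.length) (by omega) rfl hax
    exact ⟨z, m, m + n, rfl, by rw [hya, wordPow_add]⟩
  · -- `x = y c = c y`: recurse on `(c, y)`
    have hcy : c ++ y = y ++ c := by rw [← hxc, ← hxd]
    have hlen : x.length = y.length + c.length := by rw [hxc, List.length_append]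
    obtain ⟨z, m, n, rfl, rfl⟩ := ih (c.length + y.length) (by omega) rfl hcy
    exact ⟨z, n + m, n, by rw [hxc, wordPow_add], rfl⟩

/-- **Lothaire, Proposition 1.3.2** (first assertion; Lyndon–Schützenberger): two words commute,
`xy = yx`, iff they are powers of the same word.  (Lothaire states it for nonempty `x, y`; with
`x^0 = ε` it holds for all words.  The proof here is the elementary induction on `|xy|`;
Lothaire derives it from the defect theorem.) [cite: Lothaire1997, Prop 1.3.2] -/
theorem append_comm_iff_exists_wordPow {x y : List α} :
    x ++ y = y ++ x ↔ ∃ z : List α, ∃ m n : ℕ, x = wordPow z m ∧ y = wordPow z n := by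
  constructor
  · exact exists_wordPow_of_append_comm _ rfl
  · rintro ⟨z, m, n, rfl, rfl⟩
    rw [← wordPow_add, ← wordPow_add, Nat.add_comm]

/-- The two propositions combined: commuting words have a common period structure — if
`xy = yx` with `x, y` nonempty then `xy` has period `gcd |x| |y|`. [cite: Lothaire1997, Prop 1.3.2] -/
theorem hasPeriod_gcd_of_append_comm {x y : List α} (h : x ++ y = y ++ x) :
    (x ++ y).HasPeriod (Nat.gcd x.length y.length) := by
  obtain ⟨z, m, n, rfl, rfl⟩ := append_comm_iff_exists_wordPow.mp h
  rw [← wordPow_add, length_wordPow, length_wordPow, Nat.gcd_mul_right]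
  -- period `|z|` implies period `gcd(m,n)·|z|` (a multiple), via the letters of the power
  rw [List.hasPeriod_iff_getElem?]
  intro i hi
  rw [length_wordPow] at hi
  rw [getElem?_wordPow z (m + n) (by omega), getElem?_wordPow z (m + n) (by omega),
    Nat.add_mul_mod_self_right]

end Literature.Combinatorics.Words
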